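import Literature.Probability.LatticeModels.ShiftLemma
import Literature.Probability.LatticeModels.OffBoxUniqueness
import Literature.Probability.LatticeModels.CoexistenceTransport
import HarnessLib

/-!
# The good crossing above the box in the coexistence case (GH2000, Lemma 5.5, Case 3) — contour-free

Topic `Probability/LatticeModels`. Georgii–Higuchi 2000, proof of Lemma 5.5, Case 3 (p. 1162):
"`μ(E⁺_up) = μ(E⁻_up) = 1`. Then `μ`-almost surely there exists a unique semi-infinite contour
`γ_up` … By the pinning lemma and the independence of the two layers, the following event has
`ν̂`-probability at least `(θ/4)²`: in the first layer, `y` is `-∗`connected off `Δ` to `I⁻_up(ω)` …;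
in the second layer, `x` is `+∗`connected off `Δ` to `I^{+∗}_up(ω̂)` … Since `γ_up(ω)` and
`γ_up(ω̂)` intersect each other infinitely often by Lemma 5.4, the union of `p_y⁻(ω)` and `p_x⁺(ω̂)`
contains a `∗`path from `x` to `y` which by construction is a `≤∗`path for the duplicated system."

This file assembles the **contour-free** proof of the same estimate (replacing Lemmas 5.3–5.4 by
exchangeability, single-site finite energy and FKG, `GoodCrossingCaseI.lean`), taking the
conclusions of the pinning lemma (Lemma 5.2) as hypotheses in Georgii–Higuchi's form "pinned off
`Δ` to the infinite component of `I ∖ Δ`":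

1. the shift lemma (`shift_lemma_up_level`) moves the infinite `±`clusters to the level `L = m + 1`
   above the band;
2. the a.s. uniqueness of the infinite component off the box (`OffBoxUniqueness.lean`) turns a pin
   to `I ∖ Δ` into a pin to the level-`L` cluster (`measureReal_pinOffBox_le_pinLevel_plus/minus`);
3. the orientation of the level-`L` interface is a.s. constant (tail triviality) and both
   orientations are covered (`le_measureReal_upperGoodCrossing_of_level[_right]`), whatever the
   orientation at level `0` that dictates which end is pinned in which layer
   (`upperGoodCrossing_bound_of_pins_left/right`);
4. **`upperGoodCrossing_bound_of_coexistence`** — for tail-trivial `μ ∈ 𝒢(β, 0)`, `β > β_c`, with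
   infinite `+` and `-` clusters in `π_up`, and pinning bounds `≥ c_P` for far points, there is
   `c > 0` (uniform in the box) with `ν̂(≤∗-path from (-a,0) to (b,0) above Λ_n) ≥ c` for `a, b`
   large: the claim of Lemma 5.5 in Case 3, in the form consumed by
   `AizenmanHiguchiFromCrossings.lean`.

## References

* H.-O. Georgii, Y. Higuchi, *Percolation and number of phases in the two-dimensional Ising
  model*, J. Math. Phys. 41 (2000), Lemma 5.5 (proof, Case 3), Lemma 5.2 [GeorgiiHiguchi2000].
-/

noncomputable section

open MeasureTheory Filter SimpleGraph
open Literature.Probability.Percolation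
open scoped ENNReal

namespace Literature.Probability.LatticeModels

variable {β : ℝ} {μ : Measure (SpinConfig (Site 2))}

/-! ### From a pin off the box to a pin to the level-`L` cluster -/

section Glue

/-- **A `+∗`pin off the box reaches the level-`L` cluster** (Georgii–Higuchi 2000, Lemma 5.5 Case 3:
"`x` is `+∗`connected off `Δ` to `I^{+∗}_up(ω̂)`, and thus to the `+`face"): almost surely the
infinite `∗`-component of `S⁺ ∩ (π_up ∖ Λ_m)` is unique and contains the infinite `+∗`cluster of
`{x₂ ≥ L}`, `L > m`; so a `+∗`walk from `x` to it can be prolonged inside it. [cite: GeorgiiHiguchi2000, Lemma 5.5 (proof, Case 3)] -/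
theorem measureReal_pinOffBox_le_pinLevel_plus (hβc : criticalBeta 2 < β) (hμ : μ ∈ isingGibbsMeasures 2 β 0)
    {m L : ℕ} (hmL : m < L)
    (hD : ∀ᵐ ω ∂μ, ∃ x, (siteCluster zdStarGraph (spinSites 1 ω ∩ halfPlane L) x).Infinite)
    (hC : ∀ᵐ ω ∂μ, ∃ y, (siteCluster (zdGraph 2) (spinSites (-1) ω ∩ halfPlane 0) y).Infinite)
    (x : Site 2) {Q : Site 2 → Prop} (hQ : ∀ v : Site 2, 0 ≤ v 1 → v ∉ box 2 m → Q v) :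
    μ.real {ω : SpinConfig (Site 2) | ∃ z, (siteCluster zdStarGraph (spinSites 1 ω ∩ (halfPlane 0 \ ↑(box 2 m))) z).Infinite ∧
        ∃ w : zdStarGraph.Walk x z, ∀ v ∈ w.support, ω v = 1 ∧ Q v} ≤
      μ.real {ω : SpinConfig (Site 2) | ∃ z, (siteCluster zdStarGraph (spinSites 1 ω ∩ halfPlane L) z).Infinite ∧
        ∃ w : zdStarGraph.Walk x z, ∀ v ∈ w.support, ω v = 1 ∧ Q v} := by
  classical
  have hμG : IsGibbsMeasure (isingSpecification (zdGraph 2) β 0) μ := hμ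
  haveI := hμG.isProbabilityMeasure
  simp only [measureReal_def]
  refine ENNReal.toReal_mono (measure_ne_top _ _) (measure_mono_ae ?_)
  filter_upwards [ae_offBox_plusStar_unique hβc hμ, hD, hC] with ω huniq ⟨d, hd⟩ ⟨y, hy⟩
  rintro ⟨z₀, hz₀, w, hw⟩
  have hsub : spinSites 1 ω ∩ halfPlane (L : ℤ) ⊆ spinSites 1 ω ∩ (halfPlane 0 \ ↑(box 2 m)) := by
    rintro v ⟨hv, hv1⟩
    have hv1' : (L : ℤ) ≤ v 1 := hv1
    refine ⟨hv, ?_, fun hb => ?_⟩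
    · show (0 : ℤ) ≤ v 1; omega
    · rw [Finset.mem_coe, mem_box] at hb
      have := (hb 1).2; omega
  have hdO : (siteCluster zdStarGraph (spinSites 1 ω ∩ (halfPlane 0 \ ↑(box 2 m))) d).Infinite :=
    hd.mono (siteCluster_mono hsub d)
  have heq := huniq m z₀ d y hz₀ hdO hy
  have hz₀self : z₀ ∈ siteCluster zdStarGraph (spinSites 1 ω ∩ (halfPlane 0 \ ↑(box 2 m))) z₀ := by
    obtain ⟨p, hp⟩ := hz₀.nonempty
    exact (mem_siteCluster_self_iff _ _ _).2 hp.1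
  have hdself : d ∈ siteCluster zdStarGraph (spinSites 1 ω ∩ (halfPlane 0 \ ↑(box 2 m))) z₀ := by
    rw [heq]
    obtain ⟨p, hp⟩ := hdO.nonempty
    exact (mem_siteCluster_self_iff _ _ _).2 hp.1
  obtain ⟨q, hq⟩ := exists_walk_of_mem_siteCluster hz₀self hdself
  refine ⟨d, hd, w.append q, fun v hv => ?_⟩
  rw [Walk.mem_support_append_iff] at hv
  rcases hv with hv | hv
  · exact hw v hv
  · obtain ⟨hv1, hv0, hvb⟩ := hq v hv
    exact ⟨hv1, hQ v hv0 hvb⟩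

/-- **A `-`pin off the box reaches the level-`L` cluster** ("`y` is `-∗`connected off `Δ` to
`I⁻_up(ω)`, and thus to the `-`face"). [cite: GeorgiiHiguchi2000, Lemma 5.5 (proof, Case 3)] -/
theorem measureReal_pinOffBox_le_pinLevel_minus (hβc : criticalBeta 2 < β) (hμ : μ ∈ isingGibbsMeasures 2 β 0)
    {m L : ℕ} (hmL : m < L)
    (hD : ∀ᵐ ω ∂μ, ∃ x, (siteCluster zdStarGraph (spinSites 1 ω ∩ halfPlane 0) x).Infinite)
    (hC : ∀ᵐ ω ∂μ, ∃ y, (siteCluster (zdGraph 2) (spinSites (-1) ω ∩ halfPlane L) y).Infinite)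
    (x : Site 2) {Q : Site 2 → Prop} (hQ : ∀ v : Site 2, 0 ≤ v 1 → v ∉ box 2 m → Q v) :
    μ.real {ω : SpinConfig (Site 2) | ∃ z, (siteCluster (zdGraph 2) (spinSites (-1) ω ∩ (halfPlane 0 \ ↑(box 2 m))) z).Infinite ∧
        ∃ w : zdStarGraph.Walk x z, ∀ v ∈ w.support, ω v = -1 ∧ Q v} ≤
      μ.real {ω : SpinConfig (Site 2) | ∃ z, (siteCluster (zdGraph 2) (spinSites (-1) ω ∩ halfPlane L) z).Infinite ∧
        ∃ w : zdStarGraph.Walk x z, ∀ v ∈ w.support, ω v = -1 ∧ Q v} := by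
  classical
  have hμG : IsGibbsMeasure (isingSpecification (zdGraph 2) β 0) μ := hμ
  haveI := hμG.isProbabilityMeasure
  simp only [measureReal_def]
  refine ENNReal.toReal_mono (measure_ne_top _ _) (measure_mono_ae ?_)
  filter_upwards [ae_offBox_minus_unique hβc hμ, hD, hC] with ω huniq ⟨d, hd⟩ ⟨c, hc⟩
  rintro ⟨z₀, hz₀, w, hw⟩
  have hsub : spinSites (-1) ω ∩ halfPlane (L : ℤ) ⊆ spinSites (-1) ω ∩ (halfPlane 0 \ ↑(box 2 m)) := by
    rintro v ⟨hv, hv1⟩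
    have hv1' : (L : ℤ) ≤ v 1 := hv1
    refine ⟨hv, ?_, fun hb => ?_⟩
    · show (0 : ℤ) ≤ v 1; omega
    · rw [Finset.mem_coe, mem_box] at hb
      have := (hb 1).2; omega
  have hcO : (siteCluster (zdGraph 2) (spinSites (-1) ω ∩ (halfPlane 0 \ ↑(box 2 m))) c).Infinite :=
    hc.mono (siteCluster_mono hsub c)
  have heq := huniq m d z₀ c hd hz₀ hcO
  have hz₀self : z₀ ∈ siteCluster (zdGraph 2) (spinSites (-1) ω ∩ (halfPlane 0 \ ↑(box 2 m))) z₀ := by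
    obtain ⟨p, hp⟩ := hz₀.nonempty
    exact (mem_siteCluster_self_iff _ _ _).2 hp.1
  have hcself : c ∈ siteCluster (zdGraph 2) (spinSites (-1) ω ∩ (halfPlane 0 \ ↑(box 2 m))) z₀ := by
    rw [heq]
    obtain ⟨p, hp⟩ := hcO.nonempty
    exact (mem_siteCluster_self_iff _ _ _).2 hp.1
  obtain ⟨q, hq⟩ := exists_walk_of_mem_siteCluster hz₀self hcself
  refine ⟨c, hc, w.append (q.mapLe zdGraph_le_zdStarGraph), fun v hv => ?_⟩
  rw [Walk.mem_support_append_iff, Walk.support_mapLe_eq_support] at hv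
  rcases hv with hv | hv
  · exact hw v hv
  · obtain ⟨hv1, hv0, hvb⟩ := hq v hv
    exact ⟨hv1, hQ v hv0 hvb⟩

end Glue

/-! ### The estimate from the pins, orientation at level `0` fixed -/

section Pins

/-- **Case 3 estimate from the pins, `+`face on the left at level `0`**: the `+∗`pin of `x = (-a, 0)`
in the layer `ω̂` and the `-`pin of `y = (b, 0)` in the layer `ω`, both off `Λ_m` and above the band,
give the `≤∗`-walk from `x` to `y` above `Λ_m` with probability `≥ c₀ c_P²`, whatever the
orientation of the interface at the level `m + 1`. [cite: GeorgiiHiguchi2000, Lemma 5.5 (proof, Case 3)] -/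
theorem upperGoodCrossing_bound_of_pins_left (hβc : criticalBeta 2 < β) (hμ : μ ∈ isingGibbsMeasures 2 β 0)
    (hμt : IsTailTrivial μ) (s : ℤˣ)
    (hP : ∀ᵐ ω ∂μ, ∃ x, (siteCluster (zdGraph 2) (spinSites 1 ω ∩ halfPlane 0) x).Infinite)
    (hM : ∀ᵐ ω ∂μ, ∃ y, (siteCluster (zdGraph 2) (spinSites (-1) ω ∩ halfPlane 0) y).Infinite)
    {cP : ℝ} (hcP : 0 ≤ cP) (m : ℕ) {a b : ℕ}
    (hpinP : cP ≤ (μ.map (configShift (Pi.single 0 (s : ℤ)))).real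
      {ω : SpinConfig (Site 2) | ∃ z, (siteCluster zdStarGraph (spinSites 1 ω ∩ (halfPlane 0 \ ↑(box 2 m))) z).Infinite ∧
        ∃ w : zdStarGraph.Walk (![-(a : ℤ), 0]) z, ∀ v ∈ w.support,
          ω v = 1 ∧ ¬ (-(m : ℤ) ≤ v 0 ∧ v 0 ≤ m ∧ v 1 ≤ m)})
    (hpinM : cP ≤ μ.real
      {ω : SpinConfig (Site 2) | ∃ z, (siteCluster (zdGraph 2) (spinSites (-1) ω ∩ (halfPlane 0 \ ↑(box 2 m))) z).Infinite ∧
        ∃ w : zdStarGraph.Walk (![(b : ℤ), 0]) z, ∀ v ∈ w.support,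
          ω v = -1 ∧ ¬ (-(m : ℤ) ≤ v 0 ∧ v 0 ≤ m ∧ v 1 ≤ m)}) :
    ((1 - (1 + ENNReal.ofReal (Real.exp (-(8 * |β|)) / 2))⁻¹) / 2).toReal * cP * cP ≤
      (μ.prod (μ.map (configShift (Pi.single 0 (s : ℤ))))).real
        {p : SpinConfig (Site 2) × SpinConfig (Site 2) | ∃ w : zdStarGraph.Walk (![-(a : ℤ), 0]) (![(b : ℤ), 0]),
          ∀ z ∈ w.support, p.1 z ≤ p.2 z ∧ ¬ (-(m : ℤ) ≤ z 0 ∧ z 0 ≤ m ∧ z 1 ≤ m)} := by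
  classical
  have hμG : IsGibbsMeasure (isingSpecification (zdGraph 2) β 0) μ := hμ
  haveI := hμG.isProbabilityMeasure
  set θ := configShift (S := ℤˣ) (Pi.single (0 : Fin 2) (s : ℤ)) with hθ
  have hθm : Measurable θ := (configShift _).measurable
  set L : ℕ := m + 1 with hLdef
  set vL : Site 2 := -((L : ℕ) : ℤ) • (Pi.single 1 1 : Site 2) with hvL
  have hvL1 : vL 1 = -(L : ℤ) := by simp [hvL]
  have hTm : Measurable (configShift (S := ℤˣ) vL : SpinConfig (Site 2) → SpinConfig (Site 2)) :=
    (configShift _).measurable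
  -- the measures
  have hμv : μ.map θ ∈ isingGibbsMeasures 2 β 0 := mem_isingGibbsMeasures_map_configShift hμ _
  haveI : IsProbabilityMeasure (μ.map θ) := Measure.isProbabilityMeasure_map hθm.aemeasurable
  set μL : Measure (SpinConfig (Site 2)) := μ.map (configShift vL) with hμL
  have hμLG : μL ∈ isingGibbsMeasures 2 β 0 := mem_isingGibbsMeasures_map_configShift hμ _
  have hμLt : IsTailTrivial μL := hμt.map_configRelabel (Site.shift _)
  haveI : IsProbabilityMeasure μL := Measure.isProbabilityMeasure_map hTm.aemeasurable
  -- infinite clusters at level `L` (shift lemma) and at level `0`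
  have hPL : ∀ᵐ ω ∂μ, ∃ x, (siteCluster (zdGraph 2) (spinSites 1 ω ∩ halfPlane L) x).Infinite :=
    shift_lemma_up_level hμ hμt 1 hP L
  have hML : ∀ᵐ ω ∂μ, ∃ y, (siteCluster (zdGraph 2) (spinSites (-1) ω ∩ halfPlane L) y).Infinite :=
    shift_lemma_up_level hμ hμt (-1) hM L
  have hDL : ∀ᵐ ω ∂μ, ∃ x, (siteCluster zdStarGraph (spinSites 1 ω ∩ halfPlane L) x).Infinite := by
    filter_upwards [hPL] with ω ⟨x, hx⟩
    exact ⟨x, infinite_starCluster_of_latticeCluster hx⟩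
  have hD0 : ∀ᵐ ω ∂μ, ∃ x, (siteCluster zdStarGraph (spinSites 1 ω ∩ halfPlane 0) x).Infinite := by
    filter_upwards [hP] with ω ⟨x, hx⟩
    exact ⟨x, infinite_starCluster_of_latticeCluster hx⟩
  have hDLv : ∀ᵐ ω ∂(μ.map θ), ∃ x, (siteCluster zdStarGraph (spinSites 1 ω ∩ halfPlane L) x).Infinite := by
    rw [hθ, ae_exists_infinite_cluster_map_configShift_iff_star]
    simpa using hDL
  have hMv : ∀ᵐ ω ∂(μ.map θ), ∃ y, (siteCluster (zdGraph 2) (spinSites (-1) ω ∩ halfPlane 0) y).Infinite := by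
    rw [hθ, ae_exists_infinite_cluster_map_configShift_iff_lattice]
    simpa using hM
  -- the pins reach the level-`L` clusters
  have hQ : ∀ v : Site 2, 0 ≤ v 1 → v ∉ box 2 m → ¬ (-(m : ℤ) ≤ v 0 ∧ v 0 ≤ m ∧ v 1 ≤ m) := by
    intro v hv hvb h
    apply hvb
    rw [mem_box, Fin.forall_fin_two]; omega
  have hpinP' := hpinP.trans (measureReal_pinOffBox_le_pinLevel_plus hβc hμv (Nat.lt_succ_self m) hDLv hMv _ hQ)
  have hpinM' := hpinM.trans (measureReal_pinOffBox_le_pinLevel_minus hβc hμ (Nat.lt_succ_self m) hD0 hML _ hQ)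
  -- transport to the level coordinates
  have hlev : (0 : ℤ) - vL 1 = (L : ℤ) := by rw [hvL1]; ring
  have hxa : (![-(a : ℤ), -((m + 1 : ℕ) : ℤ)] : Site 2) - vL = ![-(a : ℤ), 0] := by
    rw [hvL]; ext i; fin_cases i <;> simp [hLdef]
  have hyb : (![(b : ℤ), -((m + 1 : ℕ) : ℤ)] : Site 2) - vL = ![(b : ℤ), 0] := by
    rw [hvL]; ext i; fin_cases i <;> simp [hLdef]
  have hQ' : ∀ z : Site 2, (¬ (-(m : ℤ) ≤ (z + vL) 0 ∧ (z + vL) 0 ≤ m ∧ (z + vL) 1 ≤ -1)) ↔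
      ¬ (-(m : ℤ) ≤ z 0 ∧ z 0 ≤ m ∧ z 1 ≤ m) := fun z => by
    rw [hvL]; simp [hLdef]; omega
  have hcomm : μL.map θ = (μ.map θ).map (configShift vL) := by
    rw [hμL, Measure.map_map hθm hTm, Measure.map_map hTm hθm, hθ, configShift_comm]
  have hpinx : cP ≤ (μL.map θ).real
      {ω : SpinConfig (Site 2) | ∃ z, (siteCluster zdStarGraph (spinSites 1 ω ∩ halfPlane 0) z).Infinite ∧
        ∃ w : zdStarGraph.Walk (![-(a : ℤ), -((m + 1 : ℕ) : ℤ)]) z, ∀ v ∈ w.support,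
          ω v = 1 ∧ ¬ (-(m : ℤ) ≤ v 0 ∧ v 0 ≤ m ∧ v 1 ≤ -1)} := by
    have hpre : (configShift (S := ℤˣ) vL) ⁻¹'
        {ω : SpinConfig (Site 2) | ∃ z, (siteCluster zdStarGraph (spinSites 1 ω ∩ halfPlane 0) z).Infinite ∧
          ∃ w : zdStarGraph.Walk (![-(a : ℤ), -((m + 1 : ℕ) : ℤ)]) z, ∀ v ∈ w.support,
            ω v = 1 ∧ ¬ (-(m : ℤ) ≤ v 0 ∧ v 0 ≤ m ∧ v 1 ≤ -1)} =
        {ω : SpinConfig (Site 2) | ∃ z, (siteCluster zdStarGraph (spinSites 1 ω ∩ halfPlane L) z).Infinite ∧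
          ∃ w : zdStarGraph.Walk (![-(a : ℤ), 0]) z, ∀ v ∈ w.support,
            ω v = 1 ∧ ¬ (-(m : ℤ) ≤ v 0 ∧ v 0 ≤ m ∧ v 1 ≤ m)} := by
      rw [preimage_pinPlus_configShift, hlev, hxa]
      ext ω
      simp only [Set.mem_setOf_eq]
      constructor
      · rintro ⟨z, hz, w, hw⟩; exact ⟨z, hz, w, fun v hv => ⟨(hw v hv).1, (hQ' v).1 (hw v hv).2⟩⟩
      · rintro ⟨z, hz, w, hw⟩; exact ⟨z, hz, w, fun v hv => ⟨(hw v hv).1, (hQ' v).2 (hw v hv).2⟩⟩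
    rw [hcomm, measureReal_def, Measure.map_apply hTm (measurableSet_plusPin _ _), hpre, ← measureReal_def]
    exact hpinP'
  have hpinyM : cP ≤ μL.real
      {ω : SpinConfig (Site 2) | ∃ z, (siteCluster (zdGraph 2) (spinSites (-1) ω ∩ halfPlane 0) z).Infinite ∧
        ∃ w : zdStarGraph.Walk (![(b : ℤ), -((m + 1 : ℕ) : ℤ)]) z, ∀ v ∈ w.support,
          ω v = -1 ∧ ¬ (-(m : ℤ) ≤ v 0 ∧ v 0 ≤ m ∧ v 1 ≤ -1)} := by
    have hpre : (configShift (S := ℤˣ) vL) ⁻¹'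
        {ω : SpinConfig (Site 2) | ∃ z, (siteCluster (zdGraph 2) (spinSites (-1) ω ∩ halfPlane 0) z).Infinite ∧
          ∃ w : zdStarGraph.Walk (![(b : ℤ), -((m + 1 : ℕ) : ℤ)]) z, ∀ v ∈ w.support,
            ω v = -1 ∧ ¬ (-(m : ℤ) ≤ v 0 ∧ v 0 ≤ m ∧ v 1 ≤ -1)} =
        {ω : SpinConfig (Site 2) | ∃ z, (siteCluster (zdGraph 2) (spinSites (-1) ω ∩ halfPlane L) z).Infinite ∧
          ∃ w : zdStarGraph.Walk (![(b : ℤ), 0]) z, ∀ v ∈ w.support,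
            ω v = -1 ∧ ¬ (-(m : ℤ) ≤ v 0 ∧ v 0 ≤ m ∧ v 1 ≤ m)} := by
      rw [preimage_pinMinus_configShift, hlev, hyb]
      ext ω
      simp only [Set.mem_setOf_eq]
      constructor
      · rintro ⟨z, hz, w, hw⟩; exact ⟨z, hz, w, fun v hv => ⟨(hw v hv).1, (hQ' v).1 (hw v hv).2⟩⟩
      · rintro ⟨z, hz, w, hw⟩; exact ⟨z, hz, w, fun v hv => ⟨(hw v hv).1, (hQ' v).2 (hw v hv).2⟩⟩
    rw [hμL, measureReal_def, Measure.map_apply hTm (measurableSet_minusPin _ _), hpre, ← measureReal_def]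
    exact hpinM'
  -- coexistence at level `0` for `μ_L`
  have hDL' : ∀ᵐ ω ∂μL, ∃ x, (siteCluster zdStarGraph (spinSites 1 ω ∩ halfPlane 0) x).Infinite := by
    rw [hμL, ae_exists_infinite_cluster_map_configShift_iff_star, hlev]; exact hDL
  have hCL' : ∀ᵐ ω ∂μL, ∃ y, (siteCluster (zdGraph 2) (spinSites (-1) ω ∩ halfPlane 0) y).Infinite := by
    rw [hμL, ae_exists_infinite_cluster_map_configShift_iff_lattice, hlev]; exact hML
  -- orientation of the interface at level `L`
  rcases hμLt.measure_axisUnboundedBelow (G := zdStarGraph) 1 (halfPlane 0) with h0 | h1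
  · -- `+`face on the right at level `L`: pin `(b, -L)` as "x" and `(-a, -L)` as "y", then reverse
    have hR : ∀ᵐ ω ∂μL, ∃ x, ∀ n : ℕ, ∃ k : ℤ, (n : ℤ) < k ∧
        (![k, 0] : Site 2) ∈ siteCluster zdStarGraph (spinSites 1 ω ∩ halfPlane 0) x := by
      filter_upwards [ae_axisUnbounded_below_or_above hβc hμLG, measure_eq_zero_iff_ae_notMem.1 h0, hDL']
        with ω hdich hnot ⟨x, hx⟩
      rcases hdich x hx with hb | ha
      · exact absurd ⟨x, hb⟩ hnot
      · exact ⟨x, ha⟩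
    have key := le_measureReal_upperGoodCrossing_of_level_right hβc hμ hμt s m (-(b : ℤ)) (-(a : ℤ)) hcP hR hCL'
      (by rw [neg_neg]; exact hpinyM) hpinx
    rw [setOf_exists_goodWalk_reverse]
    rw [neg_neg] at key
    exact key
  · -- `+`face on the left at level `L`
    have hL : ∀ᵐ ω ∂μL, ∃ x, ∀ n : ℕ, ∃ k : ℤ, k < -(n : ℤ) ∧
        (![k, 0] : Site 2) ∈ siteCluster zdStarGraph (spinSites 1 ω ∩ halfPlane 0) x := by
      have := (prob_compl_eq_zero_iff (measurableSet_axisUnboundedBelow_config (G := zdStarGraph) 1 (halfPlane 0))).2 h1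
      filter_upwards [measure_eq_zero_iff_ae_notMem.1 this] with ω hω
      exact not_not.1 hω
    exact le_measureReal_upperGoodCrossing_of_level hβc hμ hμt s m (a : ℤ) (b : ℤ) hcP hL hCL' hpinx hpinyM

/-- **Case 3 estimate from the pins, `+`face on the right at level `0`**: the `-`pin of `x = (-a, 0)`
in the layer `ω` and the `+∗`pin of `y = (b, 0)` in the layer `ω̂`. [cite: GeorgiiHiguchi2000, Lemma 5.5 (proof, Case 3)] -/
theorem upperGoodCrossing_bound_of_pins_right (hβc : criticalBeta 2 < β) (hμ : μ ∈ isingGibbsMeasures 2 β 0)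
    (hμt : IsTailTrivial μ) (s : ℤˣ)
    (hP : ∀ᵐ ω ∂μ, ∃ x, (siteCluster (zdGraph 2) (spinSites 1 ω ∩ halfPlane 0) x).Infinite)
    (hM : ∀ᵐ ω ∂μ, ∃ y, (siteCluster (zdGraph 2) (spinSites (-1) ω ∩ halfPlane 0) y).Infinite)
    {cP : ℝ} (hcP : 0 ≤ cP) (m : ℕ) {a b : ℕ}
    (hpinM : cP ≤ μ.real
      {ω : SpinConfig (Site 2) | ∃ z, (siteCluster (zdGraph 2) (spinSites (-1) ω ∩ (halfPlane 0 \ ↑(box 2 m))) z).Infinite ∧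
        ∃ w : zdStarGraph.Walk (![-(a : ℤ), 0]) z, ∀ v ∈ w.support,
          ω v = -1 ∧ ¬ (-(m : ℤ) ≤ v 0 ∧ v 0 ≤ m ∧ v 1 ≤ m)})
    (hpinP : cP ≤ (μ.map (configShift (Pi.single 0 (s : ℤ)))).real
      {ω : SpinConfig (Site 2) | ∃ z, (siteCluster zdStarGraph (spinSites 1 ω ∩ (halfPlane 0 \ ↑(box 2 m))) z).Infinite ∧
        ∃ w : zdStarGraph.Walk (![(b : ℤ), 0]) z, ∀ v ∈ w.support,
          ω v = 1 ∧ ¬ (-(m : ℤ) ≤ v 0 ∧ v 0 ≤ m ∧ v 1 ≤ m)}) :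
    ((1 - (1 + ENNReal.ofReal (Real.exp (-(8 * |β|)) / 2))⁻¹) / 2).toReal * cP * cP ≤
      (μ.prod (μ.map (configShift (Pi.single 0 (s : ℤ))))).real
        {p : SpinConfig (Site 2) × SpinConfig (Site 2) | ∃ w : zdStarGraph.Walk (![-(a : ℤ), 0]) (![(b : ℤ), 0]),
          ∀ z ∈ w.support, p.1 z ≤ p.2 z ∧ ¬ (-(m : ℤ) ≤ z 0 ∧ z 0 ≤ m ∧ z 1 ≤ m)} := by
  classical
  have hμG : IsGibbsMeasure (isingSpecification (zdGraph 2) β 0) μ := hμ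
  haveI := hμG.isProbabilityMeasure
  set θ := configShift (S := ℤˣ) (Pi.single (0 : Fin 2) (s : ℤ)) with hθ
  have hθm : Measurable θ := (configShift _).measurable
  set L : ℕ := m + 1 with hLdef
  set vL : Site 2 := -((L : ℕ) : ℤ) • (Pi.single 1 1 : Site 2) with hvL
  have hvL1 : vL 1 = -(L : ℤ) := by simp [hvL]
  have hTm : Measurable (configShift (S := ℤˣ) vL : SpinConfig (Site 2) → SpinConfig (Site 2)) :=
    (configShift _).measurable
  have hμv : μ.map θ ∈ isingGibbsMeasures 2 β 0 := mem_isingGibbsMeasures_map_configShift hμ _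
  haveI : IsProbabilityMeasure (μ.map θ) := Measure.isProbabilityMeasure_map hθm.aemeasurable
  set μL : Measure (SpinConfig (Site 2)) := μ.map (configShift vL) with hμL
  have hμLG : μL ∈ isingGibbsMeasures 2 β 0 := mem_isingGibbsMeasures_map_configShift hμ _
  have hμLt : IsTailTrivial μL := hμt.map_configRelabel (Site.shift _)
  haveI : IsProbabilityMeasure μL := Measure.isProbabilityMeasure_map hTm.aemeasurable
  have hPL : ∀ᵐ ω ∂μ, ∃ x, (siteCluster (zdGraph 2) (spinSites 1 ω ∩ halfPlane L) x).Infinite :=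
    shift_lemma_up_level hμ hμt 1 hP L
  have hML : ∀ᵐ ω ∂μ, ∃ y, (siteCluster (zdGraph 2) (spinSites (-1) ω ∩ halfPlane L) y).Infinite :=
    shift_lemma_up_level hμ hμt (-1) hM L
  have hDL : ∀ᵐ ω ∂μ, ∃ x, (siteCluster zdStarGraph (spinSites 1 ω ∩ halfPlane L) x).Infinite := by
    filter_upwards [hPL] with ω ⟨x, hx⟩
    exact ⟨x, infinite_starCluster_of_latticeCluster hx⟩
  have hD0 : ∀ᵐ ω ∂μ, ∃ x, (siteCluster zdStarGraph (spinSites 1 ω ∩ halfPlane 0) x).Infinite := by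
    filter_upwards [hP] with ω ⟨x, hx⟩
    exact ⟨x, infinite_starCluster_of_latticeCluster hx⟩
  have hDLv : ∀ᵐ ω ∂(μ.map θ), ∃ x, (siteCluster zdStarGraph (spinSites 1 ω ∩ halfPlane L) x).Infinite := by
    rw [hθ, ae_exists_infinite_cluster_map_configShift_iff_star]
    simpa using hDL
  have hMv : ∀ᵐ ω ∂(μ.map θ), ∃ y, (siteCluster (zdGraph 2) (spinSites (-1) ω ∩ halfPlane 0) y).Infinite := by
    rw [hθ, ae_exists_infinite_cluster_map_configShift_iff_lattice]
    simpa using hM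
  have hQ : ∀ v : Site 2, 0 ≤ v 1 → v ∉ box 2 m → ¬ (-(m : ℤ) ≤ v 0 ∧ v 0 ≤ m ∧ v 1 ≤ m) := by
    intro v hv hvb h
    apply hvb
    rw [mem_box, Fin.forall_fin_two]; omega
  have hpinP' := hpinP.trans (measureReal_pinOffBox_le_pinLevel_plus hβc hμv (Nat.lt_succ_self m) hDLv hMv _ hQ)
  have hpinM' := hpinM.trans (measureReal_pinOffBox_le_pinLevel_minus hβc hμ (Nat.lt_succ_self m) hD0 hML _ hQ)
  have hlev : (0 : ℤ) - vL 1 = (L : ℤ) := by rw [hvL1]; ring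
  have hxa : (![-(a : ℤ), -((m + 1 : ℕ) : ℤ)] : Site 2) - vL = ![-(a : ℤ), 0] := by
    rw [hvL]; ext i; fin_cases i <;> simp [hLdef]
  have hyb : (![(b : ℤ), -((m + 1 : ℕ) : ℤ)] : Site 2) - vL = ![(b : ℤ), 0] := by
    rw [hvL]; ext i; fin_cases i <;> simp [hLdef]
  have hQ' : ∀ z : Site 2, (¬ (-(m : ℤ) ≤ (z + vL) 0 ∧ (z + vL) 0 ≤ m ∧ (z + vL) 1 ≤ -1)) ↔
      ¬ (-(m : ℤ) ≤ z 0 ∧ z 0 ≤ m ∧ z 1 ≤ m) := fun z => by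
    rw [hvL]; simp [hLdef]; omega
  have hcomm : μL.map θ = (μ.map θ).map (configShift vL) := by
    rw [hμL, Measure.map_map hθm hTm, Measure.map_map hTm hθm, hθ, configShift_comm]
  have hpinyP : cP ≤ (μL.map θ).real
      {ω : SpinConfig (Site 2) | ∃ z, (siteCluster zdStarGraph (spinSites 1 ω ∩ halfPlane 0) z).Infinite ∧
        ∃ w : zdStarGraph.Walk (![(b : ℤ), -((m + 1 : ℕ) : ℤ)]) z, ∀ v ∈ w.support,
          ω v = 1 ∧ ¬ (-(m : ℤ) ≤ v 0 ∧ v 0 ≤ m ∧ v 1 ≤ -1)} := by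
    have hpre : (configShift (S := ℤˣ) vL) ⁻¹'
        {ω : SpinConfig (Site 2) | ∃ z, (siteCluster zdStarGraph (spinSites 1 ω ∩ halfPlane 0) z).Infinite ∧
          ∃ w : zdStarGraph.Walk (![(b : ℤ), -((m + 1 : ℕ) : ℤ)]) z, ∀ v ∈ w.support,
            ω v = 1 ∧ ¬ (-(m : ℤ) ≤ v 0 ∧ v 0 ≤ m ∧ v 1 ≤ -1)} =
        {ω : SpinConfig (Site 2) | ∃ z, (siteCluster zdStarGraph (spinSites 1 ω ∩ halfPlane L) z).Infinite ∧
          ∃ w : zdStarGraph.Walk (![(b : ℤ), 0]) z, ∀ v ∈ w.support,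
            ω v = 1 ∧ ¬ (-(m : ℤ) ≤ v 0 ∧ v 0 ≤ m ∧ v 1 ≤ m)} := by
      rw [preimage_pinPlus_configShift, hlev, hyb]
      ext ω
      simp only [Set.mem_setOf_eq]
      constructor
      · rintro ⟨z, hz, w, hw⟩; exact ⟨z, hz, w, fun v hv => ⟨(hw v hv).1, (hQ' v).1 (hw v hv).2⟩⟩
      · rintro ⟨z, hz, w, hw⟩; exact ⟨z, hz, w, fun v hv => ⟨(hw v hv).1, (hQ' v).2 (hw v hv).2⟩⟩
    rw [hcomm, measureReal_def, Measure.map_apply hTm (measurableSet_plusPin _ _), hpre, ← measureReal_def]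
    exact hpinP'
  have hpinxM : cP ≤ μL.real
      {ω : SpinConfig (Site 2) | ∃ z, (siteCluster (zdGraph 2) (spinSites (-1) ω ∩ halfPlane 0) z).Infinite ∧
        ∃ w : zdStarGraph.Walk (![-(a : ℤ), -((m + 1 : ℕ) : ℤ)]) z, ∀ v ∈ w.support,
          ω v = -1 ∧ ¬ (-(m : ℤ) ≤ v 0 ∧ v 0 ≤ m ∧ v 1 ≤ -1)} := by
    have hpre : (configShift (S := ℤˣ) vL) ⁻¹'
        {ω : SpinConfig (Site 2) | ∃ z, (siteCluster (zdGraph 2) (spinSites (-1) ω ∩ halfPlane 0) z).Infinite ∧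
          ∃ w : zdStarGraph.Walk (![-(a : ℤ), -((m + 1 : ℕ) : ℤ)]) z, ∀ v ∈ w.support,
            ω v = -1 ∧ ¬ (-(m : ℤ) ≤ v 0 ∧ v 0 ≤ m ∧ v 1 ≤ -1)} =
        {ω : SpinConfig (Site 2) | ∃ z, (siteCluster (zdGraph 2) (spinSites (-1) ω ∩ halfPlane L) z).Infinite ∧
          ∃ w : zdStarGraph.Walk (![-(a : ℤ), 0]) z, ∀ v ∈ w.support,
            ω v = -1 ∧ ¬ (-(m : ℤ) ≤ v 0 ∧ v 0 ≤ m ∧ v 1 ≤ m)} := by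
      rw [preimage_pinMinus_configShift, hlev, hxa]
      ext ω
      simp only [Set.mem_setOf_eq]
      constructor
      · rintro ⟨z, hz, w, hw⟩; exact ⟨z, hz, w, fun v hv => ⟨(hw v hv).1, (hQ' v).1 (hw v hv).2⟩⟩
      · rintro ⟨z, hz, w, hw⟩; exact ⟨z, hz, w, fun v hv => ⟨(hw v hv).1, (hQ' v).2 (hw v hv).2⟩⟩
    rw [hμL, measureReal_def, Measure.map_apply hTm (measurableSet_minusPin _ _), hpre, ← measureReal_def]
    exact hpinM'
  have hDL' : ∀ᵐ ω ∂μL, ∃ x, (siteCluster zdStarGraph (spinSites 1 ω ∩ halfPlane 0) x).Infinite := by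
    rw [hμL, ae_exists_infinite_cluster_map_configShift_iff_star, hlev]; exact hDL
  have hCL' : ∀ᵐ ω ∂μL, ∃ y, (siteCluster (zdGraph 2) (spinSites (-1) ω ∩ halfPlane 0) y).Infinite := by
    rw [hμL, ae_exists_infinite_cluster_map_configShift_iff_lattice, hlev]; exact hML
  rcases hμLt.measure_axisUnboundedBelow (G := zdStarGraph) 1 (halfPlane 0) with h0 | h1
  · -- `+`face on the right at level `L`
    have hR : ∀ᵐ ω ∂μL, ∃ x, ∀ n : ℕ, ∃ k : ℤ, (n : ℤ) < k ∧
        (![k, 0] : Site 2) ∈ siteCluster zdStarGraph (spinSites 1 ω ∩ halfPlane 0) x := by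
      filter_upwards [ae_axisUnbounded_below_or_above hβc hμLG, measure_eq_zero_iff_ae_notMem.1 h0, hDL']
        with ω hdich hnot ⟨x, hx⟩
      rcases hdich x hx with hb | ha
      · exact absurd ⟨x, hb⟩ hnot
      · exact ⟨x, ha⟩
    have key := le_measureReal_upperGoodCrossing_of_level_right hβc hμ hμt s m (a : ℤ) (b : ℤ) hcP hR hCL'
      hpinxM hpinyP
    simpa using key
  · -- `+`face on the left at level `L`: pin `(b, -L)` as "x" and `(-a, -L)` as "y", then reverse
    have hL : ∀ᵐ ω ∂μL, ∃ x, ∀ n : ℕ, ∃ k : ℤ, k < -(n : ℤ) ∧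
        (![k, 0] : Site 2) ∈ siteCluster zdStarGraph (spinSites 1 ω ∩ halfPlane 0) x := by
      have := (prob_compl_eq_zero_iff (measurableSet_axisUnboundedBelow_config (G := zdStarGraph) 1 (halfPlane 0))).2 h1
      filter_upwards [measure_eq_zero_iff_ae_notMem.1 this] with ω hω
      exact not_not.1 hω
    have key := le_measureReal_upperGoodCrossing_of_level hβc hμ hμt s m (-(b : ℤ)) (-(a : ℤ)) hcP hL hCL'
      (by rw [neg_neg]; exact hpinyP) hpinxM
    rw [setOf_exists_goodWalk_reverse]
    rw [neg_neg] at key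
    exact key

end Pins

/-! ### The estimate in the coexistence case -/

section Main

/-- **Georgii–Higuchi 2000, Lemma 5.5, the claim in Case 3 (contour-free proof).** Let `β > β_c(2)`,
`μ ∈ 𝒢(β, 0)` tail trivial with, almost surely, an infinite `+`cluster and an infinite `-`cluster in
the upper half-plane, and `s = ±1`. Assume the pinning bounds of Lemma 5.2: for every tail-trivial
`μ' ∈ 𝒢(β, 0)` whose infinite `+∗`cluster (resp. `-`cluster) of `π_up` touches the left (resp.
right) half-axis unboundedly there is `c_P = c_P(μ') > 0` such that for every box `Λ_m` and all axis
sites `x` far enough on that side, with `μ'`-probability `≥ c_P` the site `x` is joined by a `+∗`walk (resp.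
`-∗`walk) above the band `{|z₁| ≤ m, z₂ ≤ m}` to an infinite `∗`-component (resp. lattice component)
of the `+`sites (resp. `-`sites) of `π_up ∖ Λ_m`. Then there is `c > 0` such that for every `n`, for
all `a, b` large, with `μ ⊗ (μ∘θ_{s e₁}⁻¹)`-probability `≥ c` some `∗`-walk from `(-a, 0)` to
`(b, 0)` above the band `{|z₁| ≤ n, z₂ ≤ n}` consists of good sites `ω(z) ≤ ω̂(z)`. [cite: GeorgiiHiguchi2000, Lemma 5.5 (proof, Case 3)] -/
theorem upperGoodCrossing_bound_of_coexistence (hβc : criticalBeta 2 < β) (hμ : μ ∈ isingGibbsMeasures 2 β 0)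
    (hμt : IsTailTrivial μ) (s : ℤˣ)
    (hP : ∀ᵐ ω ∂μ, ∃ x, (siteCluster (zdGraph 2) (spinSites 1 ω ∩ halfPlane 0) x).Infinite)
    (hM : ∀ᵐ ω ∂μ, ∃ y, (siteCluster (zdGraph 2) (spinSites (-1) ω ∩ halfPlane 0) y).Infinite)
    (hPinPlusL : ∀ μ' : Measure (SpinConfig (Site 2)), μ' ∈ isingGibbsMeasures 2 β 0 → IsTailTrivial μ' →
      (∀ᵐ ω ∂μ', ∃ x, ∀ n : ℕ, ∃ k : ℤ, k < -(n : ℤ) ∧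
        (![k, 0] : Site 2) ∈ siteCluster zdStarGraph (spinSites 1 ω ∩ halfPlane 0) x) →
      ∃ cP : ℝ, 0 < cP ∧ ∀ m : ℕ, ∃ a₀ : ℕ, ∀ a : ℕ, a₀ ≤ a → cP ≤ μ'.real
        {ω : SpinConfig (Site 2) | ∃ z, (siteCluster zdStarGraph (spinSites 1 ω ∩ (halfPlane 0 \ ↑(box 2 m))) z).Infinite ∧
          ∃ w : zdStarGraph.Walk (![-(a : ℤ), 0]) z, ∀ v ∈ w.support,
            ω v = 1 ∧ ¬ (-(m : ℤ) ≤ v 0 ∧ v 0 ≤ m ∧ v 1 ≤ m)})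
    (hPinPlusR : ∀ μ' : Measure (SpinConfig (Site 2)), μ' ∈ isingGibbsMeasures 2 β 0 → IsTailTrivial μ' →
      (∀ᵐ ω ∂μ', ∃ x, ∀ n : ℕ, ∃ k : ℤ, (n : ℤ) < k ∧
        (![k, 0] : Site 2) ∈ siteCluster zdStarGraph (spinSites 1 ω ∩ halfPlane 0) x) →
      ∃ cP : ℝ, 0 < cP ∧ ∀ m : ℕ, ∃ b₀ : ℕ, ∀ b : ℕ, b₀ ≤ b → cP ≤ μ'.real
        {ω : SpinConfig (Site 2) | ∃ z, (siteCluster zdStarGraph (spinSites 1 ω ∩ (halfPlane 0 \ ↑(box 2 m))) z).Infinite ∧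
          ∃ w : zdStarGraph.Walk (![(b : ℤ), 0]) z, ∀ v ∈ w.support,
            ω v = 1 ∧ ¬ (-(m : ℤ) ≤ v 0 ∧ v 0 ≤ m ∧ v 1 ≤ m)})
    (hPinMinusL : ∀ μ' : Measure (SpinConfig (Site 2)), μ' ∈ isingGibbsMeasures 2 β 0 → IsTailTrivial μ' →
      (∀ᵐ ω ∂μ', ∃ y, ∀ n : ℕ, ∃ k : ℤ, k < -(n : ℤ) ∧
        (![k, 0] : Site 2) ∈ siteCluster (zdGraph 2) (spinSites (-1) ω ∩ halfPlane 0) y) →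
      ∃ cP : ℝ, 0 < cP ∧ ∀ m : ℕ, ∃ a₀ : ℕ, ∀ a : ℕ, a₀ ≤ a → cP ≤ μ'.real
        {ω : SpinConfig (Site 2) | ∃ z, (siteCluster (zdGraph 2) (spinSites (-1) ω ∩ (halfPlane 0 \ ↑(box 2 m))) z).Infinite ∧
          ∃ w : zdStarGraph.Walk (![-(a : ℤ), 0]) z, ∀ v ∈ w.support,
            ω v = -1 ∧ ¬ (-(m : ℤ) ≤ v 0 ∧ v 0 ≤ m ∧ v 1 ≤ m)})
    (hPinMinusR : ∀ μ' : Measure (SpinConfig (Site 2)), μ' ∈ isingGibbsMeasures 2 β 0 → IsTailTrivial μ' →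
      (∀ᵐ ω ∂μ', ∃ y, ∀ n : ℕ, ∃ k : ℤ, (n : ℤ) < k ∧
        (![k, 0] : Site 2) ∈ siteCluster (zdGraph 2) (spinSites (-1) ω ∩ halfPlane 0) y) →
      ∃ cP : ℝ, 0 < cP ∧ ∀ m : ℕ, ∃ b₀ : ℕ, ∀ b : ℕ, b₀ ≤ b → cP ≤ μ'.real
        {ω : SpinConfig (Site 2) | ∃ z, (siteCluster (zdGraph 2) (spinSites (-1) ω ∩ (halfPlane 0 \ ↑(box 2 m))) z).Infinite ∧
          ∃ w : zdStarGraph.Walk (![(b : ℤ), 0]) z, ∀ v ∈ w.support,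
            ω v = -1 ∧ ¬ (-(m : ℤ) ≤ v 0 ∧ v 0 ≤ m ∧ v 1 ≤ m)}) :
    ∃ c : ℝ≥0∞, 0 < c ∧ ∀ n : ℕ, ∃ a₀ b₀ : ℕ, ∀ a b : ℕ, a₀ ≤ a → b₀ ≤ b →
      c ≤ (μ.prod (μ.map (configShift (Pi.single 0 (s : ℤ)))))
        {p | ∃ α : zdStarGraph.Walk (![-(a : ℤ), 0]) (![(b : ℤ), 0]),
          ∀ z ∈ α.support, p.1 z ≤ p.2 z ∧ ¬ (-(n : ℤ) ≤ z 0 ∧ z 0 ≤ n ∧ z 1 ≤ n)} := by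
  classical
  have hμG : IsGibbsMeasure (isingSpecification (zdGraph 2) β 0) μ := hμ
  haveI := hμG.isProbabilityMeasure
  set θ := configShift (S := ℤˣ) (Pi.single (0 : Fin 2) (s : ℤ)) with hθ
  have hθm : Measurable θ := (configShift _).measurable
  have hμv : μ.map θ ∈ isingGibbsMeasures 2 β 0 := mem_isingGibbsMeasures_map_configShift hμ _
  have hμvt : IsTailTrivial (μ.map θ) := hμt.map_configRelabel (Site.shift _)
  haveI : IsProbabilityMeasure (μ.map θ) := Measure.isProbabilityMeasure_map hθm.aemeasurable
  -- the constant
  set δ : ℝ≥0∞ := ENNReal.ofReal (Real.exp (-(8 * |β|)) / 2) with hδ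
  set c₀ : ℝ≥0∞ := (1 - (1 + δ)⁻¹) / 2 with hc₀
  have hδpos : 0 < δ := ENNReal.ofReal_pos.2 (div_pos (Real.exp_pos _) two_pos)
  have hinv : (1 + δ)⁻¹ < 1 := ENNReal.inv_lt_one.2 (ENNReal.lt_add_right ENNReal.one_ne_top hδpos.ne')
  have hc₀ne : c₀ ≠ 0 := (ENNReal.div_pos_iff.2 ⟨(tsub_pos_iff_lt.2 hinv).ne', ENNReal.ofNat_ne_top⟩).ne'
  have hc₀top : c₀ ≠ ⊤ := ENNReal.div_ne_top (ne_top_of_le_ne_top ENNReal.one_ne_top tsub_le_self) (by norm_num)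
  have hc₀pos : 0 < c₀.toReal := ENNReal.toReal_pos hc₀ne hc₀top
  -- real bound ⇒ `ℝ≥0∞` bound
  have conv : ∀ {cP : ℝ} {n a b : ℕ}, c₀.toReal * cP * cP ≤ (μ.prod (μ.map θ)).real
      {p : SpinConfig (Site 2) × SpinConfig (Site 2) | ∃ w : zdStarGraph.Walk (![-(a : ℤ), 0]) (![(b : ℤ), 0]),
        ∀ z ∈ w.support, p.1 z ≤ p.2 z ∧ ¬ (-(n : ℤ) ≤ z 0 ∧ z 0 ≤ n ∧ z 1 ≤ n)} →
      ENNReal.ofReal (c₀.toReal * cP * cP) ≤ (μ.prod (μ.map θ))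
        {p | ∃ α : zdStarGraph.Walk (![-(a : ℤ), 0]) (![(b : ℤ), 0]),
          ∀ z ∈ α.support, p.1 z ≤ p.2 z ∧ ¬ (-(n : ℤ) ≤ z 0 ∧ z 0 ≤ n ∧ z 1 ≤ n)} := by
    intro cP n a b h
    calc ENNReal.ofReal (c₀.toReal * cP * cP) ≤ ENNReal.ofReal ((μ.prod (μ.map θ)).real
          {p : SpinConfig (Site 2) × SpinConfig (Site 2) | ∃ w : zdStarGraph.Walk (![-(a : ℤ), 0]) (![(b : ℤ), 0]),
            ∀ z ∈ w.support, p.1 z ≤ p.2 z ∧ ¬ (-(n : ℤ) ≤ z 0 ∧ z 0 ≤ n ∧ z 1 ≤ n)}) := ENNReal.ofReal_le_ofReal h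
      _ = _ := by rw [measureReal_def, ENNReal.ofReal_toReal (measure_ne_top _ _)]
  have hD0 : ∀ᵐ ω ∂μ, ∃ x, (siteCluster zdStarGraph (spinSites 1 ω ∩ halfPlane 0) x).Infinite := by
    filter_upwards [hP] with ω ⟨x, hx⟩
    exact ⟨x, infinite_starCluster_of_latticeCluster hx⟩
  -- orientation of the interface at level `0`
  rcases hμt.measure_axisUnboundedBelow (G := zdStarGraph) 1 (halfPlane 0) with h0 | h1
  · -- `+`face on the right
    have hR : ∀ᵐ ω ∂μ, ∃ x, ∀ n : ℕ, ∃ k : ℤ, (n : ℤ) < k ∧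
        (![k, 0] : Site 2) ∈ siteCluster zdStarGraph (spinSites 1 ω ∩ halfPlane 0) x := by
      filter_upwards [ae_axisUnbounded_below_or_above hβc hμ, measure_eq_zero_iff_ae_notMem.1 h0, hD0]
        with ω hdich hnot ⟨x, hx⟩
      rcases hdich x hx with hb | ha
      · exact absurd ⟨x, hb⟩ hnot
      · exact ⟨x, ha⟩
    have hRv : ∀ᵐ ω ∂(μ.map θ), ∃ x, ∀ n : ℕ, ∃ k : ℤ, (n : ℤ) < k ∧
        (![k, 0] : Site 2) ∈ siteCluster zdStarGraph (spinSites 1 ω ∩ halfPlane 0) x := by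
      rw [ae_map_iff hθm.aemeasurable (measurableSet_axisUnboundedAbove_config (G := zdStarGraph) 1 (halfPlane 0))]
      filter_upwards [hR] with ω hω
      exact (exists_plusStar_axisUnboundedAbove_configShift_iff (s : ℤ) ω).2 hω
    have hC : ∀ᵐ ω ∂μ, ∃ y, ∀ n : ℕ, ∃ k : ℤ, k < -(n : ℤ) ∧
        (![k, 0] : Site 2) ∈ siteCluster (zdGraph 2) (spinSites (-1) ω ∩ halfPlane 0) y :=
      ae_minus_axisUnboundedBelow_of_plusStar_above hβc hμ hR hM
    obtain ⟨cP₁, hcP₁, hPin₁⟩ := hPinMinusL μ hμ hμt hC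
    obtain ⟨cP₂, hcP₂, hPin₂⟩ := hPinPlusR _ hμv hμvt hRv
    have hcP : 0 < min cP₁ cP₂ := lt_min hcP₁ hcP₂
    refine ⟨ENNReal.ofReal (c₀.toReal * min cP₁ cP₂ * min cP₁ cP₂),
      ENNReal.ofReal_pos.2 (mul_pos (mul_pos hc₀pos hcP) hcP), fun n => ?_⟩
    obtain ⟨a₀, ha₀⟩ := hPin₁ n
    obtain ⟨b₀, hb₀⟩ := hPin₂ n
    refine ⟨a₀, b₀, fun a b ha hb => conv ?_⟩
    exact upperGoodCrossing_bound_of_pins_right hβc hμ hμt s hP hM hcP.le n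
      ((min_le_left _ _).trans (ha₀ a ha)) ((min_le_right _ _).trans (hb₀ b hb))
  · -- `+`face on the left
    have hL : ∀ᵐ ω ∂μ, ∃ x, ∀ n : ℕ, ∃ k : ℤ, k < -(n : ℤ) ∧
        (![k, 0] : Site 2) ∈ siteCluster zdStarGraph (spinSites 1 ω ∩ halfPlane 0) x := by
      have := (prob_compl_eq_zero_iff (measurableSet_axisUnboundedBelow_config (G := zdStarGraph) 1 (halfPlane 0))).2 h1
      filter_upwards [measure_eq_zero_iff_ae_notMem.1 this] with ω hω
      exact not_not.1 hω
    have hLv : ∀ᵐ ω ∂(μ.map θ), ∃ x, ∀ n : ℕ, ∃ k : ℤ, k < -(n : ℤ) ∧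
        (![k, 0] : Site 2) ∈ siteCluster zdStarGraph (spinSites 1 ω ∩ halfPlane 0) x := by
      rw [ae_map_iff hθm.aemeasurable (measurableSet_axisUnboundedBelow_config (G := zdStarGraph) 1 (halfPlane 0))]
      filter_upwards [hL] with ω hω
      exact (exists_plusStar_axisUnboundedBelow_configShift_iff (s : ℤ) ω).2 hω
    have hC : ∀ᵐ ω ∂μ, ∃ y, ∀ n : ℕ, ∃ k : ℤ, (n : ℤ) < k ∧
        (![k, 0] : Site 2) ∈ siteCluster (zdGraph 2) (spinSites (-1) ω ∩ halfPlane 0) y :=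
      ae_minus_axisUnboundedAbove_of_plusStar_below hβc hμ hL hM
    obtain ⟨cP₁, hcP₁, hPin₁⟩ := hPinPlusL _ hμv hμvt hLv
    obtain ⟨cP₂, hcP₂, hPin₂⟩ := hPinMinusR μ hμ hμt hC
    have hcP : 0 < min cP₁ cP₂ := lt_min hcP₁ hcP₂
    refine ⟨ENNReal.ofReal (c₀.toReal * min cP₁ cP₂ * min cP₁ cP₂),
      ENNReal.ofReal_pos.2 (mul_pos (mul_pos hc₀pos hcP) hcP), fun n => ?_⟩
    obtain ⟨a₀, ha₀⟩ := hPin₁ n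
    obtain ⟨b₀, hb₀⟩ := hPin₂ n
    refine ⟨a₀, b₀, fun a b ha hb => conv ?_⟩
    exact upperGoodCrossing_bound_of_pins_left hβc hμ hμt s hP hM hcP.le n
      ((min_le_left _ _).trans (ha₀ a ha)) ((min_le_right _ _).trans (hb₀ b hb))

end Main

end Literature.Probability.LatticeModels
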